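import Literature.MathematicalPhysics.QuantumLattice.HartreeFockBernoulliDecomposition
import Literature.MathematicalPhysics.QuantumLattice.HartreeFockBlochTorus
import Mathlib.Algebra.Order.Chebyshev
import Mathlib.Analysis.Matrix.PosDef
import HarnessLib

/-!
# Ventures/CertifiedManyBodySolver — Upper/BernoulliProductMixture.lean

HONEST FRAMING: first certified bounds; not a superconductivity verdict; every number certified or labelled float.

PRODUCT-BERNOULLI MIXTURES OF A FAMILY OF ONE-BODY BLOCKS (sr-mbsolver L3 engine seat E1; part 1 of step D2 of the Lean
route for the plaquette-dressed translation-invariant quasi-free uppers, eng-1/LEAN-GLUE-QF.md §4; theorem-only, no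
certificate value appears, nothing is claimed). The tree's `HartreeFockBernoulliDecomposition.lean` writes ONE Hermitian block
`A = Σ_ε w(ε) F_ε` as the product-Bernoulli average of its spectral projections (Lieb 1981 eq. (4)); here a FAMILY `A b`
(`b ∈ B`, later `B = spin × cell momentum`) is released AT ONCE: a pattern `E : B → (n → Bool)` selects a projector
`F^E_b = bernoulliProj (A b) (E b)` in every block, with the product weight `W(E) = Π_b w_{A b}(E b)` (written out, no definition).
* §1 `sum_prodWeight` (`Σ_E W = 1`), `prodWeight_nonneg`, **`sum_prodWeight_mul_prod`** (independence of the blocks: Fubini),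
  `sum_prodWeight_mul_apply` / `sum_prodWeight_mul_sum_card` (single-block marginals, mean particle number
  `Σ_E W(E) Σ_b #E b = Σ_b Σ_i λ_{b,i}`), **`sum_prodWeight_mul_prod_apply_of_injective`**
  (`Σ_E W(E) Π_m F^E_{β m}(i_m,j_m) = Π_m A_{β m}(i_m,j_m)` for an INJECTIVE tuple of blocks `β`);
* §2 `eigenvalues_nonneg_of_loewner` / `eigenvalues_le_one_of_loewner` (Loewner `0 ≤ A ≤ 1` ⇒ spectrum in `[0,1]`, the
  public form of the step inside `HartreeFockBlochMixture`), `norm_bernoulliProj_apply_le_one`, `norm_apply_le_one_of_eigenvalues`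
  (entries of modulus `≤ 1`), and the DEFECT of an arbitrary tuple `norm_moment_sub_prod_le`:
  `‖Σ_E W(E) Π_m F^E_{β m}(…) − Π_m A_{β m}(…)‖` is `0` for injective `β` and `≤ 2` otherwise;
* §3 small tools for the Bloch files: `card_mul_sum_ite_apply_eq` (`|K|·#{κ : ι → K | κ a = κ b} = |K|^{|ι|}`),
  `norm_blockChar`, `prod_blochMatrix_apply` (a product of `r` Bloch entries is a normalised character sum over momentum
  `r`-tuples of products of block entries), `natCast_mul_sub_one_nonneg`, `det_const_mono`, `norm_avg_linear_sub_le`.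
Consumer: `Upper/BlochDecorrelation.lean` (the `O(1/|k|)` decorrelation of Bloch entries, determinants and window reduced
density matrices under `W`). Sources: E. H. Lieb, Phys. Rev. Lett. 46 (1981) 457, eq. (4) [Lieb1981]; V. Bach, E. H. Lieb,
J. P. Solovej, J. Stat. Phys. 76 (1994) 3, Thm 2.3, eq. (3a.2) [BachLiebSolovej1994]. Everything is proved; no definition; no named fact.
-/

noncomputable section

namespace Summit.Ventures.CertifiedManyBodySolver.Upper

open Matrix Finset
open Literature.MathematicalPhysics.QuantumLattice Literature.MathematicalPhysics.QuantumLattice.HartreeFock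
open scoped ComplexOrder ComplexConjugate

/-! ### §1. Product-Bernoulli patterns over a finite family of blocks -/

section Product

variable {B : Type*} [Fintype B] [DecidableEq B] {n : Type*} [Fintype n] [DecidableEq n] {A : B → Matrix n n ℂ}

omit [DecidableEq B] in
/-- The product weights `W(E) = Π_b w_{A b}(E b)` are nonnegative when every block has spectrum in `[0,1]`.
[cite: Lieb1981, eq. (4)] -/
theorem prodWeight_nonneg (hA : ∀ b, (A b).IsHermitian) (h0 : ∀ b i, 0 ≤ (hA b).eigenvalues i) (h1 : ∀ b i, (hA b).eigenvalues i ≤ 1)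
    (E : B → n → Bool) : 0 ≤ ∏ b, bernoulliWeight (hA b) (E b) :=
  Finset.prod_nonneg fun b _ => bernoulliWeight_nonneg (hA b) (h0 b) (h1 b) (E b)

/-- Fubini for patterns: `Σ_E Π_b f b (E b) = Π_b Σ_ε f b ε`. [folklore] -/
private theorem sum_prod_pattern {R : Type*} [CommSemiring R] (f : B → (n → Bool) → R) :
    ∑ E : B → n → Bool, ∏ b, f b (E b) = ∏ b, ∑ ε : n → Bool, f b ε := by
  have h := Finset.prod_univ_sum (fun _ : B => (Finset.univ : Finset (n → Bool))) f
  rw [Fintype.piFinset_univ] at h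
  exact h.symm

/-- **The product weights sum to one** (real form). [cite: Lieb1981, eq. (4)] -/
theorem sum_prodWeight (hA : ∀ b, (A b).IsHermitian) : ∑ E : B → n → Bool, ∏ b, bernoulliWeight (hA b) (E b) = 1 := by
  rw [sum_prod_pattern (fun b ε => bernoulliWeight (hA b) ε)]
  exact Finset.prod_eq_one fun b _ => sum_bernoulliWeight (hA b)

/-- The product weights sum to one (complex form). [cite: Lieb1981, eq. (4)] -/
theorem sum_prodWeight_complex (hA : ∀ b, (A b).IsHermitian) : ∑ E : B → n → Bool, ∏ b, (bernoulliWeight (hA b) (E b) : ℂ) = 1 := by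
  have h := congrArg (fun r : ℝ => (r : ℂ)) (sum_prodWeight hA)
  push_cast at h
  exact h

omit [DecidableEq B] in
/-- `‖Π_b (w_b : ℂ)‖ = Π_b w_b` for nonnegative weights. [folklore] -/
theorem norm_prodWeight (hA : ∀ b, (A b).IsHermitian) (h0 : ∀ b i, 0 ≤ (hA b).eigenvalues i) (h1 : ∀ b i, (hA b).eigenvalues i ≤ 1)
    (E : B → n → Bool) : ‖∏ b, (bernoulliWeight (hA b) (E b) : ℂ)‖ = ∏ b, bernoulliWeight (hA b) (E b) := by
  rw [norm_prod]
  exact Finset.prod_congr rfl fun b _ => by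
    rw [Complex.norm_real, Real.norm_of_nonneg (bernoulliWeight_nonneg (hA b) (h0 b) (h1 b) (E b))]

/-- **Independence of the blocks** (Fubini): against the product weight, a product over a set `S` of blocks of functions of the
individual patterns factorises into the single-block averages. [folklore] -/
theorem sum_prodWeight_mul_prod (hA : ∀ b, (A b).IsHermitian) (S : Finset B) (g : B → (n → Bool) → ℂ) :
    ∑ E : B → n → Bool, (∏ b, (bernoulliWeight (hA b) (E b) : ℂ)) * ∏ b ∈ S, g b (E b) =
      ∏ b ∈ S, ∑ ε : n → Bool, (bernoulliWeight (hA b) ε : ℂ) * g b ε := by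
  have hterm : ∀ E : B → n → Bool, (∏ b, (bernoulliWeight (hA b) (E b) : ℂ)) * ∏ b ∈ S, g b (E b) =
      ∏ b, ((bernoulliWeight (hA b) (E b) : ℂ) * (if b ∈ S then g b (E b) else 1)) := by
    intro E
    rw [Finset.prod_mul_distrib, ← Finset.prod_filter, Finset.filter_mem_eq_inter, Finset.univ_inter]
  simp_rw [hterm]
  rw [sum_prod_pattern (fun b ε => (bernoulliWeight (hA b) ε : ℂ) * (if b ∈ S then g b ε else 1)),
    ← Finset.prod_filter_mul_prod_filter_not Finset.univ (fun b => b ∈ S), Finset.filter_mem_eq_inter, Finset.univ_inter]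
  have hout : ∏ b ∈ Finset.univ.filter (fun b => ¬ b ∈ S),
      ∑ ε : n → Bool, (bernoulliWeight (hA b) ε : ℂ) * (if b ∈ S then g b ε else 1) = 1 := by
    refine Finset.prod_eq_one fun b hb => ?_
    rw [Finset.mem_filter] at hb
    simp only [hb.2, if_false, mul_one]
    exact_mod_cast sum_bernoulliWeight (hA b)
  rw [hout, mul_one]
  exact Finset.prod_congr rfl fun b hb => by simp only [hb, if_true]

/-- **Single-block marginal** (real form): a function of the pattern of one block `b` averages to its single-block Bernoulli
average. [folklore] -/
theorem sum_prodWeight_mul_apply (hA : ∀ b, (A b).IsHermitian) (b : B) (g : (n → Bool) → ℝ) :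
    ∑ E : B → n → Bool, (∏ b', bernoulliWeight (hA b') (E b')) * g (E b) = ∑ ε : n → Bool, bernoulliWeight (hA b) ε * g ε := by
  have hterm : ∀ E : B → n → Bool, (∏ b', bernoulliWeight (hA b') (E b')) * g (E b) =
      ∏ b', (bernoulliWeight (hA b') (E b') * (if b' = b then g (E b') else 1)) := by
    intro E
    rw [Finset.prod_mul_distrib, Finset.prod_ite_eq' Finset.univ b (fun b' => g (E b'))]
    simp
  simp_rw [hterm]
  rw [sum_prod_pattern (fun b' ε => bernoulliWeight (hA b') ε * (if b' = b then g ε else 1)),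
    Finset.prod_eq_single b (fun b' _ hb' => by simp only [if_neg hb', mul_one]; exact sum_bernoulliWeight (hA b'))
      (fun h => absurd (Finset.mem_univ b) h)]
  simp only [if_true]

/-- **Mean particle number of the product decomposition**: `Σ_E W(E) · Σ_b #{i | E b i} = Σ_b Σ_i λ_{b,i}` (`= Σ_b re tr A b`).
[cite: Lieb1981, eq. (4)] -/
theorem sum_prodWeight_mul_sum_card (hA : ∀ b, (A b).IsHermitian) :
    ∑ E : B → n → Bool, (∏ b, bernoulliWeight (hA b) (E b)) * ∑ b, ((Finset.univ.filter fun i => E b i = true).card : ℝ) =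
      ∑ b, ∑ i, (hA b).eigenvalues i := by
  simp_rw [Finset.mul_sum]
  rw [Finset.sum_comm]
  refine Finset.sum_congr rfl fun b _ => ?_
  rw [sum_prodWeight_mul_apply hA b (fun ε => ((Finset.univ.filter fun i => ε i = true).card : ℝ))]
  exact sum_bernoulliWeight_mul_card (hA b)

/-- Entrywise marginal of one block: `Σ_ε w(ε) F_ε(i,j) = A(i,j)`. [cite: Lieb1981, eq. (4)] -/
theorem sum_bernoulliWeight_mul_bernoulliProj_apply {A : Matrix n n ℂ} (hA : A.IsHermitian) (i j : n) :
    ∑ ε : n → Bool, (bernoulliWeight hA ε : ℂ) * bernoulliProj hA ε i j = A i j := by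
  have h := congrFun (congrFun (sum_bernoulliWeight_smul_bernoulliProj hA) i) j
  rw [Matrix.sum_apply] at h
  simpa only [Matrix.smul_apply, smul_eq_mul] using h

/-- **Mixed moments over DISTINCT blocks**: for an injective tuple of blocks `β`, the product-weight average of a product of
entries of the selected spectral projectors is the product of the entries of the blocks (independence + marginals). [folklore] -/
theorem sum_prodWeight_mul_prod_apply_of_injective (hA : ∀ b, (A b).IsHermitian) {ι : Type*} [Fintype ι] [DecidableEq ι] {β : ι → B}
    (hβ : Function.Injective β) (i j : ι → n) :
    ∑ E : B → n → Bool, (∏ b, (bernoulliWeight (hA b) (E b) : ℂ)) * ∏ m, bernoulliProj (hA (β m)) (E (β m)) (i m) (j m) =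
      ∏ m, A (β m) (i m) (j m) := by
  classical
  rcases isEmpty_or_nonempty ι with hι | hι
  · simp only [Finset.univ_eq_empty, Finset.prod_empty, mul_one]
    exact sum_prodWeight_complex hA
  · set g : B → (n → Bool) → ℂ := fun b ε => bernoulliProj (hA b) ε (i (Function.invFun β b)) (j (Function.invFun β b)) with hg
    have hinv : ∀ m, Function.invFun β (β m) = m := Function.leftInverse_invFun hβ
    have hre : ∀ E : B → n → Bool, ∏ m, bernoulliProj (hA (β m)) (E (β m)) (i m) (j m) =
        ∏ b ∈ Finset.univ.map ⟨β, hβ⟩, g b (E b) := by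
      intro E
      rw [Finset.prod_map]
      exact Finset.prod_congr rfl fun m _ => by simp only [hg, Function.Embedding.coeFn_mk, hinv]
    simp_rw [hre]
    rw [sum_prodWeight_mul_prod hA, Finset.prod_map]
    refine Finset.prod_congr rfl fun m _ => ?_
    simp only [hg, Function.Embedding.coeFn_mk, hinv]
    exact sum_bernoulliWeight_mul_bernoulliProj_apply (hA (β m)) (i m) (j m)

end Product

/-! ### §2. Entry bounds: `|F_ε(i,j)| ≤ 1`, `|A(i,j)| ≤ 1`; the defect of one tuple of blocks -/

section Bounds

variable {n : Type*} [Fintype n] [DecidableEq n] {A : Matrix n n ℂ}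

/-- The eigenvalues of `A` with `0 ≤ A` (Loewner) are nonnegative (Mathlib `IsHermitian.posSemidef_iff_eigenvalues_nonneg`). [folklore] -/
theorem eigenvalues_nonneg_of_loewner (hA : A.IsHermitian) (h0 : A.PosSemidef) (i : n) : 0 ≤ hA.eigenvalues i :=
  (hA.posSemidef_iff_eigenvalues_nonneg.mp h0) i

/-- The eigenvalues of `A` with `A ≤ 1` (Loewner) are at most one (`1 - A = U diag(1 - λ) Uᴴ ≥ 0`). [folklore] -/
theorem eigenvalues_le_one_of_loewner (hA : A.IsHermitian) (h1 : (1 - A).PosSemidef) (i : n) : hA.eigenvalues i ≤ 1 := by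
  have key : 1 - A = Unitary.conjStarAlgAut ℂ _ hA.eigenvectorUnitary (diagonal (fun i => ((1 - hA.eigenvalues i : ℝ) : ℂ))) := by
    conv_lhs => rw [hA.spectral_theorem]
    rw [show (1 : Matrix n n ℂ) = Unitary.conjStarAlgAut ℂ _ hA.eigenvectorUnitary 1 from (map_one _).symm, ← map_sub]
    congr 1
    rw [← diagonal_one, diagonal_sub]
    congr 1
    funext i
    simp
  have h := h1
  rw [key, Unitary.conjStarAlgAut_apply, (Unitary.isUnit_coe (U := hA.eigenvectorUnitary)).posSemidef_star_right_conjugate_iff,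
    posSemidef_diagonal_iff] at h
  have hi := h i
  rw [Complex.zero_le_real] at hi
  linarith

/-- The rows of the eigenvector unitary are unit vectors: `Σ_l ‖U i l‖² = 1`. [folklore] -/
private theorem sum_norm_sq_row (hA : A.IsHermitian) (i : n) : ∑ l, ‖(hA.eigenvectorUnitary : Matrix n n ℂ) i l‖ ^ 2 = 1 := by
  set U : Matrix n n ℂ := (hA.eigenvectorUnitary : Matrix n n ℂ) with hU
  have h1 : U * star U = 1 := by rw [hU]; exact Unitary.coe_mul_star_self hA.eigenvectorUnitary
  have h2 := congrFun (congrFun h1 i) i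
  rw [Matrix.mul_apply, Matrix.one_apply_eq] at h2
  have h3 : ∀ l, U i l * (star U) l i = ((‖U i l‖ ^ 2 : ℝ) : ℂ) := fun l => by
    rw [Matrix.star_apply, Complex.star_def, Complex.mul_conj, Complex.normSq_eq_norm_sq]
  simp_rw [h3] at h2
  exact_mod_cast h2

/-- **Entries of a spectral projection have modulus at most one**: `‖F_ε(i,j)‖ ≤ 1` (Cauchy–Schwarz on the rows of the
eigenvector unitary). [folklore] -/
theorem norm_bernoulliProj_apply_le_one (hA : A.IsHermitian) (ε : n → Bool) (i j : n) : ‖bernoulliProj hA ε i j‖ ≤ 1 := by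
  set U : Matrix n n ℂ := (hA.eigenvectorUnitary : Matrix n n ℂ) with hU
  have hentry : bernoulliProj hA ε i j = ∑ l, U i l * (if ε l then (1 : ℂ) else 0) * star (U j l) := by
    unfold bernoulliProj
    rw [← hU, Matrix.mul_apply]
    exact Finset.sum_congr rfl fun l _ => by rw [Matrix.mul_diagonal, Matrix.conjTranspose_apply]
  rw [hentry]
  calc ‖∑ l, U i l * (if ε l then (1 : ℂ) else 0) * star (U j l)‖
      ≤ ∑ l, ‖U i l * (if ε l then (1 : ℂ) else 0) * star (U j l)‖ := norm_sum_le _ _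
    _ ≤ ∑ l, ‖U i l‖ * ‖U j l‖ := by
        refine Finset.sum_le_sum fun l _ => ?_
        rw [norm_mul, norm_mul, Complex.star_def, Complex.norm_conj]
        have hd : ‖(if ε l then (1 : ℂ) else 0)‖ ≤ 1 := by split_ifs <;> simp
        calc ‖U i l‖ * ‖(if ε l then (1 : ℂ) else 0)‖ * ‖U j l‖ ≤ ‖U i l‖ * 1 * ‖U j l‖ := by gcongr
          _ = ‖U i l‖ * ‖U j l‖ := by ring
    _ ≤ 1 := by
        have hcs := Finset.sum_mul_sq_le_sq_mul_sq Finset.univ (fun l => ‖U i l‖) (fun l => ‖U j l‖)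
        rw [sum_norm_sq_row hA i, sum_norm_sq_row hA j, mul_one] at hcs
        exact (sq_le_one_iff₀ (Finset.sum_nonneg fun l _ => by positivity)).1 hcs

/-- **Entries of a one-body matrix with spectrum in `[0,1]` have modulus at most one** (a convex combination of projector entries).
[folklore] -/
theorem norm_apply_le_one_of_eigenvalues (hA : A.IsHermitian) (h0 : ∀ i, 0 ≤ hA.eigenvalues i) (h1 : ∀ i, hA.eigenvalues i ≤ 1) (i j : n) :
    ‖A i j‖ ≤ 1 := by
  rw [← sum_bernoulliWeight_mul_bernoulliProj_apply hA i j]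
  calc ‖∑ ε : n → Bool, (bernoulliWeight hA ε : ℂ) * bernoulliProj hA ε i j‖
      ≤ ∑ ε : n → Bool, ‖(bernoulliWeight hA ε : ℂ) * bernoulliProj hA ε i j‖ := norm_sum_le _ _
    _ ≤ ∑ ε : n → Bool, bernoulliWeight hA ε := by
        refine Finset.sum_le_sum fun ε _ => ?_
        rw [norm_mul, Complex.norm_real, Real.norm_of_nonneg (bernoulliWeight_nonneg hA h0 h1 ε)]
        calc bernoulliWeight hA ε * ‖bernoulliProj hA ε i j‖ ≤ bernoulliWeight hA ε * 1 := by
              gcongr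
              · exact bernoulliWeight_nonneg hA h0 h1 ε
              · exact norm_bernoulliProj_apply_le_one hA ε i j
          _ = bernoulliWeight hA ε := mul_one _
    _ = 1 := sum_bernoulliWeight hA

end Bounds

section MomentBound

variable {B : Type*} [Fintype B] {n : Type*} [Fintype n] [DecidableEq n] {A : B → Matrix n n ℂ}

/-- **The decorrelation defect of one tuple of blocks**: `Σ_E W(E) Π_m F^E_{β m}(i m, j m) - Π_m A_{β m}(i m, j m)` vanishes for
injective `β` (independence + marginals) and has modulus `≤ 2` always (both terms are of modulus `≤ 1`: a convex combination of
products of projector entries, and a product of entries of blocks with spectra in `[0,1]`). [folklore] -/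
theorem norm_moment_sub_prod_le [DecidableEq B] (hA : ∀ b, (A b).IsHermitian) (h0 : ∀ b i, 0 ≤ (hA b).eigenvalues i) (h1 : ∀ b i, (hA b).eigenvalues i ≤ 1)
    {ι : Type*} [Fintype ι] [DecidableEq ι] (β : ι → B) (i j : ι → n) :
    ‖(∑ E : B → n → Bool, (∏ b, (bernoulliWeight (hA b) (E b) : ℂ)) * ∏ m, bernoulliProj (hA (β m)) (E (β m)) (i m) (j m)) -
        ∏ m, A (β m) (i m) (j m)‖ ≤ if Function.Injective β then 0 else 2 := by
  split_ifs with hβ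
  · rw [sum_prodWeight_mul_prod_apply_of_injective hA hβ, sub_self, norm_zero]
  · have hF : ∀ E : B → n → Bool, ‖∏ m, bernoulliProj (hA (β m)) (E (β m)) (i m) (j m)‖ ≤ 1 := fun E => by
      rw [norm_prod]
      exact Finset.prod_le_one (fun m _ => norm_nonneg _) fun m _ => norm_bernoulliProj_apply_le_one (hA (β m)) (E (β m)) (i m) (j m)
    have hmix : ‖∑ E : B → n → Bool, (∏ b, (bernoulliWeight (hA b) (E b) : ℂ)) *
        ∏ m, bernoulliProj (hA (β m)) (E (β m)) (i m) (j m)‖ ≤ 1 := by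
      calc _ ≤ ∑ E : B → n → Bool, ‖(∏ b, (bernoulliWeight (hA b) (E b) : ℂ)) *
            ∏ m, bernoulliProj (hA (β m)) (E (β m)) (i m) (j m)‖ := norm_sum_le _ _
        _ ≤ ∑ E : B → n → Bool, ∏ b, bernoulliWeight (hA b) (E b) := by
            refine Finset.sum_le_sum fun E _ => ?_
            rw [norm_mul, norm_prodWeight hA h0 h1 E]
            calc (∏ b, bernoulliWeight (hA b) (E b)) * ‖∏ m, bernoulliProj (hA (β m)) (E (β m)) (i m) (j m)‖
                ≤ (∏ b, bernoulliWeight (hA b) (E b)) * 1 := by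
                  gcongr
                  · exact prodWeight_nonneg hA h0 h1 E
                  · exact hF E
              _ = ∏ b, bernoulliWeight (hA b) (E b) := mul_one _
        _ = 1 := sum_prodWeight hA
    have hprod : ‖∏ m, A (β m) (i m) (j m)‖ ≤ 1 := by
      rw [norm_prod]
      exact Finset.prod_le_one (fun m _ => norm_nonneg _)
        fun m _ => norm_apply_le_one_of_eigenvalues (hA (β m)) (h0 (β m)) (h1 (β m)) (i m) (j m)
    calc _ ≤ ‖∑ E : B → n → Bool, (∏ b, (bernoulliWeight (hA b) (E b) : ℂ)) *
          ∏ m, bernoulliProj (hA (β m)) (E (β m)) (i m) (j m)‖ + ‖∏ m, A (β m) (i m) (j m)‖ := norm_sub_le _ _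
      _ ≤ 1 + 1 := add_le_add hmix hprod
      _ = 2 := by norm_num

end MomentBound

/-! ### §3. Tools for the Bloch files: counting momentum coincidences, character norms, products of Bloch entries -/

section Tools

/-- `|K| · #{κ : ι → K | κ a = κ b} = |K|^{|ι|}` for `a ≠ b` (fix the value at `a`; the other coordinates are free). [folklore] -/
theorem card_mul_sum_ite_apply_eq {ι K : Type*} [Fintype ι] [DecidableEq ι] [Fintype K] [DecidableEq K] {a b : ι} (hab : b ≠ a) :
    (Fintype.card K : ℝ) * ∑ κ : ι → K, (if κ a = κ b then (1 : ℝ) else 0) = (Fintype.card K : ℝ) ^ Fintype.card ι := by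
  classical
  have h1 : ∑ κ : ι → K, (if κ a = κ b then (1 : ℝ) else 0) =
      ∑ g : K × ({j // j ≠ a} → K), (if g.1 = g.2 ⟨b, hab⟩ then (1 : ℝ) else 0) := by
    rw [← (Equiv.piSplitAt a (fun _ : ι => K)).symm.sum_comp]
    exact Fintype.sum_congr _ _ fun g => by simp [Equiv.piSplitAt, hab]
  have h2 : ∑ g : K × ({j // j ≠ a} → K), (if g.1 = g.2 ⟨b, hab⟩ then (1 : ℝ) else 0) = (Fintype.card ({j // j ≠ a} → K) : ℝ) := by
    rw [Fintype.sum_prod_type, Finset.sum_comm]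
    simp
  have h3 : Fintype.card ({j // j ≠ a} → K) = Fintype.card K ^ (Fintype.card ι - 1) := by
    rw [Fintype.card_fun, Fintype.card_subtype_compl, Fintype.card_subtype_eq]
  have hι : 1 ≤ Fintype.card ι := Fintype.card_pos_iff.2 ⟨a⟩
  rw [h1, h2, h3, Nat.cast_pow, ← pow_succ', Nat.sub_add_cancel hι]

/-- `0 ≤ r (r - 1)` for a natural number `r` (read in `ℝ`). [folklore] -/
theorem natCast_mul_sub_one_nonneg (r : ℕ) : (0 : ℝ) ≤ (r : ℝ) * ((r : ℝ) - 1) := by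
  rcases Nat.eq_zero_or_pos r with h | h
  · simp [h]
  · have h1 : (1 : ℝ) ≤ r := by exact_mod_cast h
    exact mul_nonneg (by positivity) (by linarith)

/-- Monotonicity of the determinant constant: `n! · 2n(n-1)/c ≤ w! · 2w²/c` for `n ≤ w`, `c > 0`. [folklore] -/
theorem det_const_mono {n w : ℕ} (hnw : n ≤ w) {c : ℝ} (hc : 0 < c) :
    (n.factorial : ℝ) * (2 * (n : ℝ) * ((n : ℝ) - 1) / c) ≤ (w.factorial : ℝ) * (2 * (w : ℝ) ^ 2 / c) := by
  have hf : (n.factorial : ℝ) ≤ w.factorial := by exact_mod_cast Nat.factorial_le hnw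
  have hn : (n : ℝ) ≤ w := by exact_mod_cast hnw
  have hn0 : (0 : ℝ) ≤ n := Nat.cast_nonneg _
  have h1 : 2 * (n : ℝ) * ((n : ℝ) - 1) ≤ 2 * (w : ℝ) ^ 2 := by nlinarith
  have h2 : 0 ≤ 2 * (n : ℝ) * ((n : ℝ) - 1) / c := div_nonneg (by nlinarith [natCast_mul_sub_one_nonneg n]) hc.le
  calc (n.factorial : ℝ) * (2 * (n : ℝ) * ((n : ℝ) - 1) / c) ≤ (w.factorial : ℝ) * (2 * (n : ℝ) * ((n : ℝ) - 1) / c) := by gcongr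
    _ ≤ (w.factorial : ℝ) * (2 * (w : ℝ) ^ 2 / c) := by gcongr

/-- Pulling a finite linear combination through an average and bounding it termwise. [folklore] -/
theorem norm_avg_linear_sub_le {Ω S : Type*} [Fintype Ω] (S₀ : Finset S) (W : Ω → ℂ) (c : S → ℂ) (F : Ω → S → ℂ)
    (G : S → ℂ) (δ : S → ℝ) (hδ : ∀ s ∈ S₀, ‖(∑ ω, W ω * F ω s) - G s‖ ≤ δ s) :
    ‖(∑ ω, W ω * ∑ s ∈ S₀, c s * F ω s) - ∑ s ∈ S₀, c s * G s‖ ≤ ∑ s ∈ S₀, ‖c s‖ * δ s := by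
  have h : (∑ ω, W ω * ∑ s ∈ S₀, c s * F ω s) - ∑ s ∈ S₀, c s * G s = ∑ s ∈ S₀, c s * ((∑ ω, W ω * F ω s) - G s) := by
    simp_rw [Finset.mul_sum]
    rw [Finset.sum_comm, ← Finset.sum_sub_distrib]
    refine Finset.sum_congr rfl fun s _ => ?_
    rw [mul_sub, Finset.mul_sum]
    congr 1
    exact Finset.sum_congr rfl fun ω _ => by ring
  rw [h]
  calc _ ≤ ∑ s ∈ S₀, ‖c s * ((∑ ω, W ω * F ω s) - G s)‖ := norm_sum_le _ _
    _ ≤ ∑ s ∈ S₀, ‖c s‖ * δ s := Finset.sum_le_sum fun s hs => by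
        rw [norm_mul]
        gcongr
        exact hδ s hs

variable {d L : ℕ} {k M : Fin d → ℕ} [∀ i, NeZero (k i)] [∀ i, NeZero (M i)]

/-- `‖χ_κ(X)‖ = 1` for the cell-lattice characters of `HartreeFockBlochTorus`. [folklore] -/
theorem norm_blockChar (κ X : RectTorusSite k) : ‖blockChar κ X‖ = 1 := by
  have h := blockChar_mul_conj κ X
  rw [Complex.mul_conj, Complex.normSq_eq_norm_sq] at h
  have h2 : ‖blockChar κ X‖ ^ 2 = 1 := by exact_mod_cast h
  nlinarith [h2, norm_nonneg (blockChar κ X)]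

/-- **A product of Bloch entries is a normalised character sum of products of block entries**:
`Π_m P_{G m}(x m, y m) = |k|^{-|ι|} Σ_{κ : ι → cells} (Π_m χ_{κ m}(X_m - Y_m)) Π_m G m (κ m) (x̄_m, ȳ_m)`. [folklore] -/
theorem prod_blochMatrix_apply (hkM : ∀ i, k i * M i = L) {ι : Type*} [Fintype ι] [DecidableEq ι]
    (G : ι → RectTorusSite k → Matrix (RectTorusSite M) (RectTorusSite M) ℂ) (x y : ι → FermionTorus d L) :
    ∏ m, blochMatrix hkM (G m) (x m) (y m) = ((Fintype.card (RectTorusSite k) : ℂ)⁻¹) ^ Fintype.card ι *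
      ∑ κ : ι → RectTorusSite k, (∏ m, blockChar (κ m) (cellIndex hkM (x m) - cellIndex hkM (y m))) *
        ∏ m, G m (κ m) (cellPos hkM (x m)) (cellPos hkM (y m)) := by
  simp_rw [blochMatrix_apply]
  rw [Finset.prod_mul_distrib, Finset.prod_const, Finset.card_univ]
  congr 1
  rw [Finset.prod_univ_sum, Fintype.piFinset_univ]
  exact Finset.sum_congr rfl fun κ _ => by rw [Finset.prod_mul_distrib]

end Tools

end Summit.Ventures.CertifiedManyBodySolver.Upper
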